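import Literature.Probability.RandomPlanarGeometry.RestrictionLeftFillLaw
import Literature.Probability.RandomPlanarGeometry.RestrictionMeasuresProofs
import HarnessLib

/-!
# [LSW] Thm. 7.3 as the existence-with-bubbles leaf: `P_α`, `α > 5/8`, exists and is carried by configurations with interior points

Level 4 of the decomposition of the named fact
`Literature.Probability.RandomPlanarGeometry.IsRestrictionMeasure.eq_five_eighths_of_outer_simple`
(file `RestrictionMeasures`; plan in `RestrictionMeasuresFiveEighths`, assembly from the two
deep leaves in `RestrictionLeftFillLaw`), after

* G. F. Lawler, O. Schramm, W. Werner, *Conformal restriction: the chordal case*, J. Amer. Math.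
  Soc. **16** (2003) 917–955, arXiv:math/0209343 (**[LSW]**), §7 "Bubbles": §7.1 (the Brownian
  bubble measures `ν` and `μ`), Remark 7.2 (Poisson clouds of bubbles), §7.2 and **Thm. 7.3**
  (p. 29): "For any `κ ∈ [0, 8/3]`, the law of `Ξ(κ)` is `P_{α_κ}`", with the paragraph after its
  proof: "The theorem shows that for all `α > 5/8`, the measure `P_α` exists and can be
  constructed by adding bubbles with appropriate intensity to SLE_κ with `κ = 6/(2α + 1)`";
* the same construction in book form: G. F. Lawler, *Conformally Invariant Processes in the
  Plane*, AMS (2005) (**[Law]**), §9.4 "Constructing restriction measures" (p. 213) with the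
  bubble soup of Def. 5.31 (§5.7) and §5.5.

THE POINT OF THIS FILE. The `α > 5/8` leaf of p. 5 result 2 used so far,
`IsRestrictionMeasure.ae_interior_nonempty_of_gt_five_eighths` ("for EVERY `P` with
`IsRestrictionMeasure α P`, `α > 5/8`, almost every configuration has an interior point"), is
the conjunction of two things of a different nature: the UNIQUENESS of `P_α` ([LSW] Prop. 3.3,
last sentence) — which is a theorem of the tree (`IsRestrictionMeasure.unique'`,
`RestrictionMeasuresProofs`, from the π-system property of the avoidance events) — and what
Thm. 7.3 actually prints, an EXISTENCE statement with structure: the law of the explicit random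
set `Ξ(κ) = Fill(γ(0, ∞) ∪ ⋃ X̂)` (an SLE_κ curve `γ` decorated with the conformal images
`g_t⁻¹(K + W_t)` of a Poisson cloud `X` of filled Brownian bubbles `K` of intensity
`λ_κ μ × dt`) is `P_{α_κ}`, where for `κ ∈ (0, 8/3)` — i.e. `α_κ = (6 − κ)/(2κ) ∈ (5/8, ∞)` — the
intensity `λ_κ = (8 − 3κ)(6 − κ)/(2κ)` is positive, so that `Ξ(κ)` contains bubbles, each of
which contains an open set. We therefore vendor the leaf in its printed, existential form

* `Literature.Probability.RandomPlanarGeometry.exists_isRestrictionMeasure_ae_interior_nonempty` —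
  NAMED FACT ([LSW] Thm. 7.3 with §7.1–7.2): for every `α > 5/8` THERE IS a probability measure
  `P` on `Ω` with `IsRestrictionMeasure α P` under which almost every configuration has an
  interior point (the law of `Ξ(6/(2α + 1))`);

and PROVE from it, by uniqueness (`IsRestrictionMeasure.ae_of_exists`):

* `IsRestrictionMeasure.ae_interior_nonempty_of_gt_five_eighths_of_exists` — the old leaf;
* `exists_isRestrictionMeasure_of_gt_five_eighths_of_bubbles` — the `α > 5/8` part of the "if"
  half of p. 5 result 1 (`exists_isRestrictionMeasure_iff`), of which Thm. 7.3 is also the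
  printed source (the case `α = 5/8` being Thm. 6.1, SLE_{8/3});
* `exists_isRestrictionMeasure_ae_interior_nonempty_iff` — conversely the new leaf is EXACTLY
  "existence for `α > 5/8`" ∧ "the old leaf" (nothing is smuggled in);
* `IsRestrictionMeasure.measure_interior_nonempty_eq_one`, `measure_interior_eq_empty_eq_zero`
  — the event forms `P_α{int K ≠ ∅} = 1`, `P_α{int K = ∅} = 0` (the events are measurable for
  the avoidance σ-field, `RestrictionConfig.measurableSet_interior_nonempty`, proved in
  `RestrictionConfigEvents`);
* `IsRestrictionMeasure.map_of_measure_disjoint`,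
  `exists_isRestrictionMeasure_ae_interior_nonempty_of_construction` — what "the law of `Ξ` is
  `P_α`" means on `Ω` and the form in which a CONSTRUCTION delivers the leaf: a random
  configuration `Ξ` on a probability space, measurable for the avoidance σ-field, with
  `ℙ[Ξ ∩ A = ∅] = Φ'_A(0)^α` for all `A ∈ 𝒬*` and `int Ξ ≠ ∅` almost surely, has an image law
  witnessing the leaf (PROVED; the target of any future formalisation of Thm. 7.3's `Ξ(κ)`);
* `IsRestrictionMeasure.eq_five_eighths_of_outer_simple_of_oneSided_of_bubbles` (and the `∀ᵐ`
  reading `eq_five_eighths_of_simple_of_oneSided_of_bubbles`) — [LSW] p. 5 result 2, first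
  sentence, from the two printed existential leaves that now remain: the SLE(8/3, ρ) input of
  Cor. 8.6 (`exists_isRightRestrictionMeasure_lt_five_eighths`, §8) and the present one (§7).

What "the law of `Ξ` is `P_α`" means on `Ω`: `Ξ ∈ Ω` almost surely (the last part of the proof
of Thm. 7.3, "all that remains is to show that `cl Ξ = Ξ ∪ {0}`") and `ω ↦ Ξ(ω)` is measurable
for the σ-field generated by the avoidance events `{K ∩ A = ∅}`, `A ∈ 𝒬*` ([LSW] §3 p. 10), its
image law satisfying `P[Ξ ∩ A = ∅] = Φ'_A(0)^α` (the display preceding Thm. 7.3). The interior-point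
clause combines three inputs that [LSW] does not spell out and that are standard: (S1) a Poisson
point process whose intensity measure has infinite total mass — here `λ_κ μ × dt` on
`Ω_b × [0, ∞)`, `λ_κ > 0`, `μ` "σ-finite but infinite" (§7.1) — has (infinitely many) points
almost surely; (S2) the filling of a planar Brownian path run for positive time (here: of a
Brownian excursion, §7.1, locally absolutely continuous with respect to Brownian motion) has an
interior point almost surely, the complement of the path having bounded connected components;
(S3) `z ↦ g_t⁻¹(z + W_t)` is a conformal map of `ℍ` onto `ℍ ∖ γ(0, t]`, hence open, so
`Ξ ⊇ g_t⁻¹(int K + W_t)`, a nonempty open set. NOT in the tree, hence the fact is not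
discharged here: SLE_κ as a random simple curve for `κ < 8/3` ([RS]; the tree's named fact
`ae_isSimpleTrace_sleTrace_of_le_four`), Brownian excursions and the bubble measure `μ` with
`μ[K ∩ A ≠ ∅] = −S g_A(0)/6` (§7.1), Poisson point processes of hulls, the martingale identity
Thm. 6.5 (`Φ'_A(0)^α = E[1_{γ ∩ A = ∅} exp(λ ∫₀^∞ S h_s(W_s)/6 ds)]`, from Prop. 5.3) and
Thm. 7.3 itself; see the session notes of the literature-prover for the planned decomposition
of the present leaf along these printed statements.
-/

noncomputable section

open Set Filter MeasureTheory
open scoped NNReal ENNReal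

namespace Literature.Probability.RandomPlanarGeometry

/-! ### The leaf: [LSW] Thm. 7.3 in existential form -/

/-- NAMED FACT — **[LSW] Theorem 7.3 (p. 29) with §7.1–7.2: for `α > 5/8` the restriction
measure `P_α` exists and is carried by configurations with interior points.** Printed: "For
any `κ ∈ [0, 8/3]`, the law of `Ξ(κ)` is `P_{α_κ}`" (Thm. 7.3), where (§7.2)
`α_κ = (6 − κ)/(2κ)`, `λ_κ = (8 − 3κ)(6 − κ)/(2κ)`, `X` is "a Poisson point process on
`Ω_b × [0, ∞)` with mean (intensity) `λ μ × dt`" independent of the SLE_κ path `γ` (`g_t` its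
Loewner maps, `W_t` its driving process; "Since `κ ≤ 8/3`, we know from [RS] that `γ` is a
simple curve"), `X̂ := {g_t⁻¹(K + W_t) : (K, t) ∈ X}` and `Ξ = Ξ(κ) := Fill(γ(0, ∞) ∪ ⋃ X̂)`;
(§7.1) `μ`, "the measure on Brownian bubbles at `0`", is the image under `z ↦ −1/z` of `ν`, "a
σ-finite but infinite measure on unbounded closed connected sets", the limit of `y/π` times the
law of the filling `Fill(Z[0, ∞))` of a Brownian excursion `Z` started on the line `Im z = y`,
and lives on "the space `Ω_b` of connected bounded sets `K ⊂ ℍ` such that `cl K = K ∪ {0}` and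
`ℍ ∖ K` is connected", with `μ[K ∩ A ≠ ∅] = −S g_A(0)/6` for `A ∈ 𝒬*`; and, after the proof of
Thm. 7.3, "The theorem shows that for all `α > 5/8`, the measure `P_α` exists and can be
constructed by adding bubbles with appropriate intensity to SLE_κ with `κ = 6/(2α + 1)`" — for
`α > 5/8` this `κ` lies in `(0, 8/3)`, where `λ_κ > 0`. Hence, with the standard facts (S1) a
Poisson point process with an intensity measure of infinite mass has points almost surely,
(S2) a filled Brownian bubble has an interior point `μ`-almost everywhere, (S3) the conformal
maps `z ↦ g_t⁻¹(z + W_t) : ℍ → ℍ ∖ γ(0, t]` are open: almost surely `Ξ ⊇ g_t⁻¹(int K + W_t) ≠ ∅`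
is open for some `(K, t) ∈ X`, i.e. `Ξ` has an interior point. Here `P_α` = any `P` with
`IsRestrictionMeasure α P` ([LSW] Prop. 3.3 (3) / Def. 3.4), "the law of `Ξ` is `P_α`" is read on
the σ-field of `Ω` generated by the avoidance events (§3 p. 10), for which `{K : int K ≠ ∅}` is
measurable (`RestrictionConfig.measurableSet_interior_nonempty`), so that the `∀ᵐ` clause is
`P{int K ≠ ∅} = 1`. The same construction in book form: [Law] §9.4 (p. 213), with the bubble
soup of Def. 5.31. By the uniqueness of `P_α` this existential statement is equivalent to the
conjunction of "`P_α` exists for `α > 5/8`" and `IsRestrictionMeasure.ae_interior_nonempty_of_gt_five_eighths`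
(`exists_isRestrictionMeasure_ae_interior_nonempty_iff`).
[cite: LawlerSchrammWerner2003Restriction, Thm. 7.3 (p. 29) with §7.1–7.2 and Prop. 3.3] -/
def exists_isRestrictionMeasure_ae_interior_nonempty : Prop :=
  ∀ α : ℝ, 5 / 8 < α →
    ∃ P : Measure RestrictionConfig, IsRestrictionMeasure α P ∧
      ∀ᵐ K : RestrictionConfig ∂P, (interior (K : Set ℂ)).Nonempty

/-! ### Consequences by uniqueness of `P_α` -/

/-- **The old leaf from the new one**: if for each `α > 5/8` SOME restriction measure of
exponent `α` is carried by configurations with interior points (Thm. 7.3), then EVERY `P` with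
`IsRestrictionMeasure α P`, `α > 5/8`, is — `P_α` is unique ([LSW] Prop. 3.3, last sentence;
`IsRestrictionMeasure.ae_of_exists`).
[cite: LawlerSchrammWerner2003Restriction, Thm. 7.3 (p. 29) with Prop. 3.3 (pp. 10–11)] -/
theorem IsRestrictionMeasure.ae_interior_nonempty_of_gt_five_eighths_of_exists
    (h73 : exists_isRestrictionMeasure_ae_interior_nonempty) :
    IsRestrictionMeasure.ae_interior_nonempty_of_gt_five_eighths :=
  fun hP hα ↦ IsRestrictionMeasure.ae_of_exists (h73 _ hα) hP

/-- **Existence of `P_α` for `α > 5/8`** (the `α > 5/8` part of the "if" half of [LSW] p. 5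
result 1, `exists_isRestrictionMeasure_iff`; printed source Thm. 7.3, the case `α = 5/8` being
Thm. 6.1), from the leaf. [cite: LawlerSchrammWerner2003Restriction, Thm. 7.3 (p. 29) and p. 5 result 1] -/
theorem exists_isRestrictionMeasure_of_gt_five_eighths_of_bubbles
    (h73 : exists_isRestrictionMeasure_ae_interior_nonempty) {α : ℝ} (hα : 5 / 8 < α) :
    ∃ P : Measure RestrictionConfig, IsRestrictionMeasure α P := by
  obtain ⟨P, hP, -⟩ := h73 α hα
  exact ⟨P, hP⟩

/-- **The new leaf is exactly existence plus the old leaf**: by the uniqueness of `P_α`,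
`exists_isRestrictionMeasure_ae_interior_nonempty` is equivalent to the conjunction of
"for every `α > 5/8` some `P_α` exists" and
`IsRestrictionMeasure.ae_interior_nonempty_of_gt_five_eighths`.
[cite: LawlerSchrammWerner2003Restriction, Thm. 7.3 (p. 29) with Prop. 3.3 (pp. 10–11)] -/
theorem exists_isRestrictionMeasure_ae_interior_nonempty_iff :
    exists_isRestrictionMeasure_ae_interior_nonempty ↔
      (∀ α : ℝ, 5 / 8 < α → ∃ P : Measure RestrictionConfig, IsRestrictionMeasure α P) ∧
        IsRestrictionMeasure.ae_interior_nonempty_of_gt_five_eighths := by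
  constructor
  · exact fun h ↦ ⟨fun α hα ↦ exists_isRestrictionMeasure_of_gt_five_eighths_of_bubbles h hα,
      IsRestrictionMeasure.ae_interior_nonempty_of_gt_five_eighths_of_exists h⟩
  · rintro ⟨hex, hae⟩ α hα
    obtain ⟨P, hP⟩ := hex α hα
    exact ⟨P, hP, hae hP hα⟩

/-- In particular the new leaf follows from p. 5 result 1 (`exists_isRestrictionMeasure_iff`,
for the existence) and the old leaf. [cite: LawlerSchrammWerner2003Restriction, p. 5 result 1 and Thm. 7.3 (p. 29)] -/
theorem exists_isRestrictionMeasure_ae_interior_nonempty_of_iff_of_ae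
    (h1 : exists_isRestrictionMeasure_iff)
    (hae : IsRestrictionMeasure.ae_interior_nonempty_of_gt_five_eighths) :
    exists_isRestrictionMeasure_ae_interior_nonempty :=
  exists_isRestrictionMeasure_ae_interior_nonempty_iff.2
    ⟨fun α hα ↦ (h1 α (by linarith)).2 hα.le, hae⟩

/-- **`P_α{int K ≠ ∅} = 1` for `α > 5/8`**: the event form of the leaf, for every restriction
measure of exponent `α > 5/8` (the event is measurable, `RestrictionConfig.measurableSet_interior_nonempty`).
[cite: LawlerSchrammWerner2003Restriction, Thm. 7.3 (p. 29) with Prop. 3.3 (pp. 10–11)] -/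
theorem IsRestrictionMeasure.measure_interior_nonempty_eq_one
    (h73 : exists_isRestrictionMeasure_ae_interior_nonempty) {α : ℝ}
    {P : Measure RestrictionConfig} (hP : IsRestrictionMeasure α P) (hα : 5 / 8 < α) :
    P {K | (interior (K : Set ℂ)).Nonempty} = 1 := by
  haveI := hP.isProbabilityMeasure
  have hae := IsRestrictionMeasure.ae_interior_nonempty_of_gt_five_eighths_of_exists h73 hP hα
  rw [← measure_univ (μ := P)]
  refine measure_congr ?_
  filter_upwards [hae] with K hK
  exact propext ⟨fun _ ↦ trivial, fun _ ↦ hK⟩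

/-- **`P_α{int K = ∅} = 0` for `α > 5/8`**: the complementary event form (in particular the
simple curves, which have empty interior — `RestrictionConfig.IsSimplePath.interior_eq_empty` —,
are contained in a `P_α`-null measurable event; cf.
`IsRestrictionMeasure.exists_measure_lt_one_of_gt_five_eighths`).
[cite: LawlerSchrammWerner2003Restriction, Thm. 7.3 (p. 29) with Prop. 3.3 (pp. 10–11)] -/
theorem IsRestrictionMeasure.measure_interior_eq_empty_eq_zero
    (h73 : exists_isRestrictionMeasure_ae_interior_nonempty) {α : ℝ}
    {P : Measure RestrictionConfig} (hP : IsRestrictionMeasure α P) (hα : 5 / 8 < α) :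
    P {K | interior (K : Set ℂ) = ∅} = 0 := by
  have hae := IsRestrictionMeasure.ae_interior_nonempty_of_gt_five_eighths_of_exists h73 hP hα
  refine measure_eq_zero_iff_ae_notMem.2 ?_
  filter_upwards [hae] with K hK
  simpa [Set.nonempty_iff_ne_empty] using hK

/-! ### What "the law of `Ξ` is `P_α`" means on `Ω`: image laws of random configurations

The form in which a CONSTRUCTION (such as [LSW] Thm. 7.3's `Ξ(κ)` on the product of the Wiener
space and the space of the Poisson cloud) delivers the leaf: a random configuration
`Ξ : Ω' → Ω` on a probability space, measurable for the avoidance σ-field — i.e. each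
`{ω : Ξ(ω) ∩ A = ∅}`, `A ∈ 𝒬*`, is an event —, with `ℙ[Ξ ∩ A = ∅] = Φ'_A(0)^α` for all
`A ∈ 𝒬*` (the display preceding Thm. 7.3) and `int Ξ ≠ ∅` almost surely, has an image law
which is a restriction measure of exponent `α` carried by configurations with interior points. -/

section RandomConfiguration

variable {Ω' : Type*} [MeasurableSpace Ω'] {ℙ : Measure Ω'} {Ξ : Ω' → RestrictionConfig}

/-- A map into `Ω` is measurable for the avoidance σ-field ([LSW] §3 p. 10) as soon as the
avoidance events of `*`-hulls pull back to events. [cite: LawlerSchrammWerner2003Restriction, §3 p. 10 (the σ-field on Ω)] -/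
theorem RestrictionConfig.measurable_of_measurableSet_disjoint
    (h : ∀ A : Set ℂ, IsStarHull A → MeasurableSet {ω | Disjoint ((Ξ ω : Set ℂ)) A}) :
    Measurable Ξ :=
  measurable_generateFrom fun _ ⟨A, hA, hS⟩ ↦ hS ▸ h A hA

/-- **The image law of a random configuration with the restriction avoidance probabilities is
`P_α`**: if `ℙ[Ξ ∩ A = ∅] = Φ'_A(0)^α` for every `A ∈ 𝒬*` (every restriction map `Φ_A` and
its derivative `Φ'_A(0)` at `0`), then `IsRestrictionMeasure α (ℙ ∘ Ξ⁻¹)` — the reading of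
"the law of `Ξ` is `P_α`" ([LSW] Thm. 7.3; Def. 3.4).
[cite: LawlerSchrammWerner2003Restriction, Def. 3.4 with Prop. 3.3 (3) (pp. 10–11) and Thm. 7.3 (p. 29)] -/
theorem IsRestrictionMeasure.map_of_measure_disjoint [IsProbabilityMeasure ℙ] (hΞ : Measurable Ξ)
    {α : ℝ}
    (h : ∀ {A : Set ℂ}, IsStarHull A →
      ∀ {Φ : ConformalEquiv (UpperHalfPlane.upperHalfPlaneSet \ A) UpperHalfPlane.upperHalfPlaneSet},
        IsRestrictionMap A Φ → ∀ {d : ℝ}, HasRestrictionDeriv A Φ d →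
          ℙ {ω | Disjoint ((Ξ ω : Set ℂ)) A} = ENNReal.ofReal (d ^ α)) :
    IsRestrictionMeasure α (ℙ.map Ξ) := by
  refine ⟨Measure.isProbabilityMeasure_map hΞ.aemeasurable, fun hA Φ hΦ d hd ↦ ?_⟩
  rw [Measure.map_apply hΞ (RestrictionConfig.measurableSet_avoid hA)]
  exact h hA hΦ hd

/-- Almost sure interior points transfer to the image law (the event `{int K ≠ ∅}` is
measurable, `RestrictionConfig.measurableSet_interior_nonempty`). [folklore] -/
theorem RestrictionConfig.ae_map_interior_nonempty (hΞ : Measurable Ξ)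
    (h : ∀ᵐ ω ∂ℙ, (interior ((Ξ ω : Set ℂ))).Nonempty) :
    ∀ᵐ K : RestrictionConfig ∂(ℙ.map Ξ), (interior (K : Set ℂ)).Nonempty :=
  (ae_map_iff hΞ.aemeasurable RestrictionConfig.measurableSet_interior_nonempty).2 h

end RandomConfiguration

/-- **The leaf from a construction** (the shape of [LSW] Thm. 7.3 and its proof): if for every
`α > 5/8` some probability space carries a random configuration `Ξ`, measurable for the
avoidance σ-field, with `ℙ[Ξ ∩ A = ∅] = Φ'_A(0)^α` for all `A ∈ 𝒬*` and `int Ξ ≠ ∅` almost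
surely, then `exists_isRestrictionMeasure_ae_interior_nonempty` holds (witness: the image law).
The probability space is quantified in `Type`; [LSW]'s witness is `Ξ(6/(2α + 1))` on the
product of the Wiener space with the space of the Poisson cloud of bubbles.
[cite: LawlerSchrammWerner2003Restriction, Thm. 7.3 (p. 29) and the display preceding it] -/
theorem exists_isRestrictionMeasure_ae_interior_nonempty_of_construction
    (h : ∀ α : ℝ, 5 / 8 < α →
      ∃ (Ω' : Type) (_ : MeasurableSpace Ω') (ℙ : Measure Ω') (_ : IsProbabilityMeasure ℙ)
        (Ξ : Ω' → RestrictionConfig), Measurable Ξ ∧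
          (∀ {A : Set ℂ}, IsStarHull A →
            ∀ {Φ : ConformalEquiv (UpperHalfPlane.upperHalfPlaneSet \ A)
                UpperHalfPlane.upperHalfPlaneSet},
              IsRestrictionMap A Φ → ∀ {d : ℝ}, HasRestrictionDeriv A Φ d →
                ℙ {ω | Disjoint ((Ξ ω : Set ℂ)) A} = ENNReal.ofReal (d ^ α)) ∧
          ∀ᵐ ω ∂ℙ, (interior ((Ξ ω : Set ℂ))).Nonempty) :
    exists_isRestrictionMeasure_ae_interior_nonempty := by
  intro α hα
  obtain ⟨Ω', _, ℙ, _, Ξ, hΞ, havoid, hint⟩ := h α hα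
  exact ⟨ℙ.map Ξ, IsRestrictionMeasure.map_of_measure_disjoint hΞ havoid,
    RestrictionConfig.ae_map_interior_nonempty hΞ hint⟩

/-! ### [LSW] p. 5 result 2 from the two existential leaves -/

/-- **[LSW] p. 5 result 2, first sentence (outer reading), from the two printed existential
leaves**: the SLE(8/3, ρ) input of Cor. 8.6 (`h84`, §8: for `0 < α < 5/8` some `P⁺_α` exists
with `P⁺_α{i ∉ K} > 1/2`) and Thm. 7.3 in existential form (`h73`, §7: for `α > 5/8` some
`P_α` exists with an interior point almost surely); uniqueness of `P_α` and `P⁺_α`, positivity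
of the exponent, `F^{ℝ₊}_ℍ(P_α) = P⁺_α`, the symmetry bound, measurability of `{int K ≠ ∅}` and
the emptiness of the interior of simple curves are theorems of the tree.
[cite: LawlerSchrammWerner2003Restriction, p. 5 result 2; Thm. 7.3 (p. 29), Thm. 8.4 and Cor. 8.6 (pp. 37–38)] -/
theorem IsRestrictionMeasure.eq_five_eighths_of_outer_simple_of_oneSided_of_bubbles
    (h84 : exists_isRightRestrictionMeasure_lt_five_eighths)
    (h73 : exists_isRestrictionMeasure_ae_interior_nonempty) :
    IsRestrictionMeasure.eq_five_eighths_of_outer_simple :=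
  IsRestrictionMeasure.eq_five_eighths_of_outer_simple_of_leaves h84
    (IsRestrictionMeasure.ae_interior_nonempty_of_gt_five_eighths_of_exists h73)

/-- The almost-everywhere reading (`IsRestrictionMeasure.eq_five_eighths_of_simple`) from the
same two existential leaves. [cite: LawlerSchrammWerner2003Restriction, p. 5 result 2; Thm. 7.3 (p. 29), Thm. 8.4 and Cor. 8.6 (pp. 37–38)] -/
theorem IsRestrictionMeasure.eq_five_eighths_of_simple_of_oneSided_of_bubbles
    (h84 : exists_isRightRestrictionMeasure_lt_five_eighths)
    (h73 : exists_isRestrictionMeasure_ae_interior_nonempty) :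
    IsRestrictionMeasure.eq_five_eighths_of_simple :=
  IsRestrictionMeasure.eq_five_eighths_of_simple_of_outer
    (IsRestrictionMeasure.eq_five_eighths_of_outer_simple_of_oneSided_of_bubbles h84 h73)

end Literature.Probability.RandomPlanarGeometry

end
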